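import Literature.IUT.LogThetaLattice.PacketLogVolumes
import Literature.IUT.LogThetaLattice.RealifiedSemisimplificationProofs
import HarnessLib

/-!
# [IUTchIII] Proposition 3.9 (iv) (b) "log-link compatibility" at the GENUINE `p`-adic logarithm — proof-only
# companion of `PacketLogVolumes.lean` (abc-iut cell, layer L6, slice [IUTchIII] §3)

S. Mochizuki, *Inter-universal Teichmüller theory III*, kurims manuscript (May 2020), §3, Proposition 3.9 (iv)
(b), p. 117 [claim: Mochizuki2012, status: disputed]: "At the level of the `ℚ`-spans of log-shells '`𝓘^ℚ((−))`'
that arise from the various `𝓕`-prime-strips involved, the log-volumes of (a) indexed by `(n, m)` are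
compatible — in the sense discussed in Propositions 1.2, (iii); 1.3, (iii) — with the corresponding
log-volumes indexed by `(n, m−1)`, relative to the log-link `^{n,m−1}𝓗𝓣 →^{log} ^{n,m}𝓗𝓣`" — i.e. (Prop. 1.2
(iii) p. 31, Remark 3.9.6 p. 145: on "sufficiently small" regions) the log-link is log-volume compatible
where it is defined, the classical [AbsTopIII] Prop. 5.7 (i) (c) "`μ_k(S) = μ_k(log_k(S))` for compact
`S ⊆ 𝒪^×_k` on which `log_k` is injective".

abc-iut-L6-t4's statement file types (iv)(a) as the datum `Prop39iv_a X` of a log-volume on the regions of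
each `(n, m)`-indexed copy and (iv)(b) as the predicate `Prop39iv_b X vol lg Adm` over the partial map `lg`
underlying the log-link `(n, m−1) → (n, m)` and the class `Adm` of admissible ("sufficiently small") regions
(`PacketLogVolumes.lean`, p404053; consumed by abc-iut-c312-8's `Cor312Remarks2`). This file DISCHARGES (b)
at one nonarchimedean place over the genuine `p`-adic logarithm (abc-iut-S1's `unitLog = log_p` on a
mixed-characteristic local field `K`, `[NormedAlgebra ℚ_[p] K] [IsUltrametricDist K] [ProperSpace K]`):

* data: `X n m := K` for every lattice position (all the `^{n,m}𝓕_v` being copies of `K_v`); `vol n m S :=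
  log μ(S)` for an additive Haar measure `μ` (the log-volume of [AbsTopIII] Prop. 5.7 (i); any
  normalisation); `lg n m x := log_p x` if `x ∈ 𝒪^×_K = {‖x‖ = 1}` and undefined (`none`) otherwise (Def. 1.1
  (i): the log-link is defined on the units); `Adm n m :=` the compact subsets of `𝒪^×_K` on which `log_p` is
  injective (Remark 3.9.6 "sufficiently small"; [AbsTopIII] Prop. 5.7 (i)(c));
* **`prop39iv_b_unitLog`** — `Prop39iv_b` HOLDS for this data: the set of values of `lg` on `S ∈ Adm` is
  `log_p(S)` (`lgImage_eq_image_unitLog`) and `μ(log_p(S)) = μ(S)` is abc-iut-L6-d5's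
  `measure_image_unitLog_eq` (`RealifiedSemisimplificationProofs.lean`, the discharge of Remark 3.9.4 (iii),
  built on abc-iut-L3-t11's `isIsometricOnSmallBalls_unitLog`); the same with plain volumes instead of
  log-volumes (`prop39iv_b_unitLog_measure`).

No new definitions; classical `p`-adic analysis; nothing here bears on the disputed [IUTchIII] Cor. 3.12 or
takes a side; typed ≠ discharged elsewhere.
-/

noncomputable section

namespace Literature.IUT.LogThetaLattice

open _root_.MeasureTheory Set Metric Literature.IUT.LogVolume

universe u

section Values

variable (K : Type u) [NontriviallyNormedField K]

open Classical in
/-- The set of values of the partial log-link map on a set `S` of UNITS is `log_p(S)` ([IUTchIII] Def. 1.1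
(i) p. 23: the log-link is defined on `𝒪^×`). [claim: Mochizuki2012, status: disputed] -/
theorem lgImage_eq_image_unitLog {S : Set K} (hS : S ⊆ {x : K | ‖x‖ = 1}) :
    {y : K | ∃ x ∈ S, (if ‖x‖ = 1 then some (unitLog x) else none) = some y} = unitLog '' S := by
  ext y
  simp only [Set.mem_setOf_eq, Set.mem_image]
  constructor
  · rintro ⟨x, hx, h⟩
    have hx1 : ‖x‖ = 1 := hS hx
    rw [if_pos hx1] at h
    exact ⟨x, hx, Option.some.inj h⟩
  · rintro ⟨x, hx, rfl⟩
    have hx1 : ‖x‖ = 1 := hS hx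
    exact ⟨x, hx, by rw [if_pos hx1]⟩

end Values

section LogLink

variable (p : ℕ) [Fact p.Prime]
variable (K : Type u) [NontriviallyNormedField K] [instK : NormedAlgebra ℚ_[p] K] [IsUltrametricDist K]
  [ProperSpace K] [MeasurableSpace K] [BorelSpace K]

include instK

open Classical in
/-- **IUTchIII:Prop3.9(iv)(b)** (kurims p. 117) at one nonarchimedean place, UNCONDITIONALLY at the genuine
`p`-adic logarithm, volume form: for every additive Haar measure `μ` on `K`, every lattice position and every
compact `S ⊆ 𝒪^×_K` on which `log_p` is injective, `μ({values of the log-link on S}) = μ(S)` — abc-iut-L6-t4's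
`Prop39iv_b` HOLDS for `X n m := K`, `vol := (μ ·).toReal`, `lg :=` the partial `log_p`, `Adm :=` compact
subsets of the units where `log_p` is injective. [claim: Mochizuki2012, status: disputed] -/
theorem prop39iv_b_unitLog_measure (μ : Measure K) [μ.IsAddHaarMeasure] :
    Prop39iv_b (fun _ _ : ℤ => K) (fun _ _ S => (μ S).toReal)
      (fun _ _ x => if ‖x‖ = 1 then some (unitLog x) else none)
      (fun _ _ => {S | S ⊆ {x : K | ‖x‖ = 1} ∧ IsCompact S ∧ Set.InjOn (unitLog (K := K)) S}) := by
  intro n m S hS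
  obtain ⟨hSU, hSc, hinj⟩ := hS
  dsimp only
  rw [lgImage_eq_image_unitLog K hSU, measure_image_unitLog_eq p K μ hSU hSc hinj]

open Classical in
/-- **IUTchIII:Prop3.9(iv)(b)** (kurims p. 117) at one nonarchimedean place, UNCONDITIONALLY at the genuine
`p`-adic logarithm, LOG-volume form (`μ^log = log μ`, [AbsTopIII] Prop. 5.7 (i)): `Prop39iv_b` HOLDS for
`X n m := K`, `vol := log μ(·)`, the partial `log_p` and the compact subsets of `𝒪^×_K` on which `log_p` is
injective — "the log-volumes … indexed by `(n, m)` are compatible … with the corresponding log-volumes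
indexed by `(n, m−1)`, relative to the log-link". [claim: Mochizuki2012, status: disputed] -/
theorem prop39iv_b_unitLog (μ : Measure K) [μ.IsAddHaarMeasure] :
    Prop39iv_b (fun _ _ : ℤ => K) (fun _ _ S => Real.log (μ S).toReal)
      (fun _ _ x => if ‖x‖ = 1 then some (unitLog x) else none)
      (fun _ _ => {S | S ⊆ {x : K | ‖x‖ = 1} ∧ IsCompact S ∧ Set.InjOn (unitLog (K := K)) S}) := by
  intro n m S hS
  obtain ⟨hSU, hSc, hinj⟩ := hS
  dsimp only
  rw [lgImage_eq_image_unitLog K hSU, measure_image_unitLog_eq p K μ hSU hSc hinj]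

end LogLink

end Literature.IUT.LogThetaLattice
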